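import Mathlib.Analysis.InnerProductSpace.PiL2
import Mathlib.Analysis.InnerProductSpace.Projection.FiniteDimensional
import Mathlib.Analysis.InnerProductSpace.Projection.Reflection
import Mathlib.Analysis.SpecialFunctions.Complex.Arg
import HarnessLib

/-!
# Rotations about two coordinate axes and one coordinate reflection generate `O(3)`

Topic `Literature/Geometry/Euclidean`.  Pure group theory of the orthogonal group of
`ℝ³ = EuclideanSpace ℝ (Fin 3)` (no continuity, no connectedness):

> **Theorem (folklore).** Let `Γ` be a subgroup of the orthogonal group `O(3)` containing, for every
> angle `φ`, the rotation `R₂(φ) : (x₀, x₁, x₂) ↦ (cos φ x₀ + sin φ x₁, −sin φ x₀ + cos φ x₁, x₂)` about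
> the third coordinate axis and the rotation
> `R₁(φ) : (x₀, x₁, x₂) ↦ (cos φ x₀ + sin φ x₂, x₁, −sin φ x₀ + cos φ x₂)` about the second one, and the
> coordinate reflection `(x₀, x₁, x₂) ↦ (−x₀, x₁, x₂)`.  Then `Γ = O(3)`.

(`subgroup_eq_top_of_axisRotations`; the function form `apply_comp_eq_of_axisRotations`: a function of
configurations `ι → ℝ³` invariant under the two families of coordinate rotations and the coordinate
reflection is invariant under every linear isometry.)

Proof.  Every vector `u` is moved onto the first axis `ℝ e₀` by an element of `Γ`: first rotate about
the third axis to kill the second coordinate, then about the second axis to kill the third one (the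
angles exist by the polar form of a complex number).  The coordinate reflection is the reflection
`θ_{e₀}` in the plane `(ℝ ∙ e₀)ᗮ`.  Hyperplane reflections are conjugated by isometries,
`θ_{γ v} = γ θ_v γ⁻¹` (Mathlib `Submodule.reflection_map`), and do not see a rescaling of the normal;
hence `Γ` contains `θ_v` for every `v` (for `v = 0` the reflection in `(ℝ ∙ 0)ᗮ = ⊤` is the identity),
and the reflections generate `O(3)` by the Cartan–Dieudonné theorem (Mathlib
`LinearIsometryEquiv.reflections_generate`).  All auxiliary computations are kept inside the two proofs
(the tree already has them as lemmas of a `Summits/` file, which a `Literature/` file cannot import).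

The sign conventions of `R₂`, `R₁` are those of the tree's coordinate-plane rotations
`Literature.MathematicalPhysics.QuantumFieldTheory.planeRot 0 φ`, `planeRot 1 φ` on `ℝ³`, which is how the
statement is consumed (rotation invariance of scaling limits of lattice models from invariance about the
lattice axes); the file is deliberately Mathlib-only.  The argument is the one of the tree file
`Summits/CriticalPhenomena/Ising3DConformalLimit/Theorems/GaussianScaleMixtureRotationUpgradeFromTwoPointRotationsFromTwoCircles.lean`
(there for a conjugate frame and the pair of axes `e₂, e₀`), restated vocabulary-free.

References: E. Artin, *Geometric Algebra* (1957), Thm. 3.20 (Cartan–Dieudonné); folklore (Euler angles).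
-/

noncomputable section

namespace Literature.Geometry.Euclidean

/-- **Rotations about two coordinate axes and one coordinate reflection generate `O(3)`.**  A subgroup
`Γ` of the orthogonal group of `ℝ³` that contains, for every angle `φ`, an element acting as the rotation
`R₂(φ) : x ↦ (cos φ x₀ + sin φ x₁, −sin φ x₀ + cos φ x₁, x₂)` about the third axis and one acting as the
rotation `R₁(φ) : x ↦ (cos φ x₀ + sin φ x₂, x₁, −sin φ x₀ + cos φ x₂)` about the second axis, and the
reflection `θ_{e₀}` in the coordinate plane `(ℝ ∙ e₀)ᗮ`, is everything.  (Every vector is aligned with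
`e₀` by the two rotations — the angles exist by the polar form of a complex number —, so every
hyperplane reflection `θ_v = γ⁻¹ θ_{e₀} γ`, `γ ∈ Γ`, lies in `Γ`; the reflections generate `O(3)` by
Cartan–Dieudonné, Mathlib `LinearIsometryEquiv.reflections_generate`.) [folklore] -/
theorem subgroup_eq_top_of_axisRotations
    (Γ : Subgroup (EuclideanSpace ℝ (Fin 3) ≃ₗᵢ[ℝ] EuclideanSpace ℝ (Fin 3)))
    (h₂ : ∀ φ : ℝ, ∃ T ∈ Γ, ∀ x, T x = WithLp.toLp 2
      ![Real.cos φ * x 0 + Real.sin φ * x 1, -Real.sin φ * x 0 + Real.cos φ * x 1, x 2])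
    (h₁ : ∀ φ : ℝ, ∃ T ∈ Γ, ∀ x, T x = WithLp.toLp 2
      ![Real.cos φ * x 0 + Real.sin φ * x 2, x 1, -Real.sin φ * x 0 + Real.cos φ * x 2])
    (h₀ : (ℝ ∙ EuclideanSpace.single (0 : Fin 3) (1 : ℝ))ᗮ.reflection ∈ Γ) :
    Γ = ⊤ := by
  classical
  -- reflections in (propositionally) equal subspaces agree
  have hcongr : ∀ {K L : Submodule ℝ (EuclideanSpace ℝ (Fin 3))}
      [K.HasOrthogonalProjection] [L.HasOrthogonalProjection], K = L → K.reflection = L.reflection := by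
    intro K L _ _ h
    subst h
    rfl
  -- conjugation: `θ_{γ v} = γ θ_v γ⁻¹` (`Submodule.reflection_map`, `Submodule.map_orthogonal_equiv`)
  have hconj : ∀ (γ : EuclideanSpace ℝ (Fin 3) ≃ₗᵢ[ℝ] EuclideanSpace ℝ (Fin 3))
      (v : EuclideanSpace ℝ (Fin 3)), (ℝ ∙ γ v)ᗮ.reflection = γ * (ℝ ∙ v)ᗮ.reflection * γ⁻¹ := by
    intro γ v
    have hK : ((ℝ ∙ v)ᗮ).map
        (γ.toLinearEquiv : EuclideanSpace ℝ (Fin 3) →ₗ[ℝ] EuclideanSpace ℝ (Fin 3)) = (ℝ ∙ γ v)ᗮ := by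
      rw [Submodule.map_orthogonal_equiv, Submodule.map_span, Set.image_singleton]
      rfl
    rw [← hcongr hK, Submodule.reflection_map]
    rfl
  -- rescaling the normal does not change the reflection
  have hsmul : ∀ {c : ℝ}, c ≠ 0 → ∀ v : EuclideanSpace ℝ (Fin 3),
      (ℝ ∙ (c • v))ᗮ.reflection = (ℝ ∙ v)ᗮ.reflection :=
    fun hc v => hcongr (by rw [Submodule.span_singleton_smul_eq hc.isUnit])
  -- an angle `φ` with `sin φ · a + cos φ · b = 0` (polar form of `a + b i`)
  have hangle : ∀ a b : ℝ, ∃ φ : ℝ, Real.sin φ * a + Real.cos φ * b = 0 := by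
    intro a b
    refine ⟨-Complex.arg ⟨a, b⟩, ?_⟩
    have hc : ‖(⟨a, b⟩ : ℂ)‖ * Real.cos (Complex.arg ⟨a, b⟩) = a := Complex.norm_mul_cos_arg ⟨a, b⟩
    have hs : ‖(⟨a, b⟩ : ℂ)‖ * Real.sin (Complex.arg ⟨a, b⟩) = b := Complex.norm_mul_sin_arg ⟨a, b⟩
    rw [Real.sin_neg, Real.cos_neg]
    linear_combination Real.sin (Complex.arg ⟨a, b⟩) * hc - Real.cos (Complex.arg ⟨a, b⟩) * hs
  choose T₂ hT₂Γ hT₂ using h₂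
  choose T₁ hT₁Γ hT₁ using h₁
  -- (1) every vector is moved onto the axis `ℝ ∙ e₀` by an element of `Γ`: first kill the second
  -- coordinate by a rotation about the third axis, then the third one by a rotation about the second
  have hmove : ∀ u : EuclideanSpace ℝ (Fin 3), ∃ T ∈ Γ, ∃ r : ℝ,
      T u = r • EuclideanSpace.single (0 : Fin 3) (1 : ℝ) := by
    intro u
    obtain ⟨φ₁, e₁⟩ := hangle (-u 0) (u 1)
    obtain ⟨φ₂, e₂⟩ := hangle (-(Real.cos φ₁ * u 0 + Real.sin φ₁ * u 1)) (u 2)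
    refine ⟨T₁ φ₂ * T₂ φ₁, Γ.mul_mem (hT₁Γ φ₂) (hT₂Γ φ₁),
      Real.cos φ₂ * (Real.cos φ₁ * u 0 + Real.sin φ₁ * u 1) + Real.sin φ₂ * u 2, ?_⟩
    rw [LinearIsometryEquiv.coe_mul, Function.comp_apply, hT₂, hT₁]
    ext j
    fin_cases j
    · simp
    · simp
      linear_combination e₁
    · simp
      linear_combination e₂
  -- (2) every hyperplane reflection lies in `Γ`
  have hall : ∀ v : EuclideanSpace ℝ (Fin 3), (ℝ ∙ v)ᗮ.reflection ∈ Γ := by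
    intro v
    by_cases hv : v = 0
    · -- the reflection in `(ℝ ∙ 0)ᗮ = ⊤` is the identity
      have h1 : (ℝ ∙ (v : EuclideanSpace ℝ (Fin 3)))ᗮ.reflection = 1 := by
        refine LinearIsometryEquiv.ext fun x => ?_
        rw [LinearIsometryEquiv.coe_one, id_eq]
        apply Submodule.reflection_mem_subspace_eq_self
        rw [hv, Submodule.mem_orthogonal_singleton_iff_inner_right, inner_zero_left]
      rw [h1]
      exact Γ.one_mem
    obtain ⟨T, hT, r, hr⟩ := hmove v
    have hr0 : r ≠ 0 := by
      rintro rfl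
      rw [zero_smul] at hr
      exact hv (T.injective (by rw [hr, map_zero]))
    have hTv : (ℝ ∙ T v)ᗮ.reflection ∈ Γ := by
      rw [hr, hsmul hr0]
      exact h₀
    have h2 : (ℝ ∙ T⁻¹ (T v))ᗮ.reflection ∈ Γ := by
      rw [hconj]
      exact Γ.mul_mem (Γ.mul_mem (Γ.inv_mem hT) hTv) (Γ.inv_mem (Γ.inv_mem hT))
    rwa [LinearIsometryEquiv.coe_inv, T.symm_apply_apply] at h2
  -- (3) Cartan–Dieudonné: reflections generate the orthogonal group
  refine top_le_iff.mp ?_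
  rw [← LinearIsometryEquiv.reflections_generate, Subgroup.closure_le]
  rintro _ ⟨v, rfl⟩
  exact hall v

/-- **Function form.**  A function `f` of configurations `ι → ℝ³` that is invariant under (isometries
acting as) the rotations `R₂(φ)` about the third axis and `R₁(φ)` about the second axis for every
angle `φ`, and under the coordinate reflection `x ↦ (−x₀, x₁, x₂)`, is invariant under every linear
isometry of `ℝ³`: its invariance group is a subgroup as in `subgroup_eq_top_of_axisRotations`, the
coordinate reflection being the reflection in the plane `(ℝ ∙ e₀)ᗮ`. [folklore] -/
theorem apply_comp_eq_of_axisRotations {ι : Type*} {β : Sort*} (f : (ι → EuclideanSpace ℝ (Fin 3)) → β)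
    (h₂ : ∀ φ : ℝ, ∃ T : EuclideanSpace ℝ (Fin 3) ≃ₗᵢ[ℝ] EuclideanSpace ℝ (Fin 3),
      (∀ y, T y = WithLp.toLp 2
        ![Real.cos φ * y 0 + Real.sin φ * y 1, -Real.sin φ * y 0 + Real.cos φ * y 1, y 2]) ∧
      ∀ x : ι → EuclideanSpace ℝ (Fin 3), f (fun i => T (x i)) = f x)
    (h₁ : ∀ φ : ℝ, ∃ T : EuclideanSpace ℝ (Fin 3) ≃ₗᵢ[ℝ] EuclideanSpace ℝ (Fin 3),
      (∀ y, T y = WithLp.toLp 2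
        ![Real.cos φ * y 0 + Real.sin φ * y 2, y 1, -Real.sin φ * y 0 + Real.cos φ * y 2]) ∧
      ∀ x : ι → EuclideanSpace ℝ (Fin 3), f (fun i => T (x i)) = f x)
    (h₀ : ∀ x : ι → EuclideanSpace ℝ (Fin 3), f (fun i => WithLp.toLp 2 ![-(x i) 0, x i 1, x i 2]) = f x)
    (R : EuclideanSpace ℝ (Fin 3) ≃ₗᵢ[ℝ] EuclideanSpace ℝ (Fin 3)) (x : ι → EuclideanSpace ℝ (Fin 3)) :
    f (fun i => R (x i)) = f x := by
  -- the coordinate reflection is the reflection in the plane `(ℝ ∙ e₀)ᗮ`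
  have hrefl : ∀ y : EuclideanSpace ℝ (Fin 3),
      (ℝ ∙ EuclideanSpace.single (0 : Fin 3) (1 : ℝ))ᗮ.reflection y = WithLp.toLp 2 ![-y 0, y 1, y 2] := by
    intro y
    rw [Submodule.reflection_orthogonal_apply, Submodule.reflection_singleton_apply]
    ext j
    fin_cases j
    · simp [EuclideanSpace.inner_single_left]
      ring
    · simp [EuclideanSpace.inner_single_left]
    · simp [EuclideanSpace.inner_single_left]
  -- the invariance group of `f`
  let Γ : Subgroup (EuclideanSpace ℝ (Fin 3) ≃ₗᵢ[ℝ] EuclideanSpace ℝ (Fin 3)) :=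
    { carrier := {T | ∀ x : ι → EuclideanSpace ℝ (Fin 3), f (fun i => T (x i)) = f x}
      mul_mem' := by
        intro a b ha hb x
        have hab : (fun i => (a * b) (x i)) = fun i => a (b (x i)) := rfl
        rw [hab, ha (fun i => b (x i)), hb x]
      one_mem' := by
        intro x
        rfl
      inv_mem' := by
        intro a ha x
        have h := ha (fun i => a⁻¹ (x i))
        have hx : (fun i => a (a⁻¹ (x i))) = x := funext fun i => a.apply_symm_apply (x i)
        rw [hx] at h
        exact h.symm }
  have hΓ : Γ = ⊤ := by
    refine subgroup_eq_top_of_axisRotations Γ ?_ ?_ ?_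
    · intro φ
      obtain ⟨T, hT, hTf⟩ := h₂ φ
      exact ⟨T, hTf, hT⟩
    · intro φ
      obtain ⟨T, hT, hTf⟩ := h₁ φ
      exact ⟨T, hTf, hT⟩
    · intro x
      have hx : (fun i => (ℝ ∙ EuclideanSpace.single (0 : Fin 3) (1 : ℝ))ᗮ.reflection (x i)) =
          fun i => WithLp.toLp 2 ![-(x i) 0, x i 1, x i 2] :=
        funext fun i => hrefl (x i)
      rw [hx]
      exact h₀ x
  have hR : R ∈ Γ := by
    rw [hΓ]
    exact Subgroup.mem_top R
  exact hR x

end Literature.Geometry.Euclidean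

end
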